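import Mathlib
import HarnessLib
import Summits.NavierStokesRegularity.NavierStokesRegularity.Theorems.TypeIQuarterGateScarEnvelopeTypeIForcedTsaiSemantics

/-!
# ARM B lane E-exact — smoothness of the witness field (first half of stub S1)

`WitnessRow.contDiff_field : ContDiff ℝ ∞ r.field` for `U(y) = e^{−a|y|²}·u(y)`: coordinates are
continuous linear, monomials are products of powers, sparse polynomials are finite sums, the Gaussian is
`exp` of a polynomial.  (The second half of S1, `div U = 0`, reduces by `…ForcedTsaiFieldCalculus` to the
value-level commutation of the symbolic operators `Dg`; left to the lineage.)  Nothing here bears on NS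
regularity.
-/

noncomputable section

set_option linter.dupNamespace false

namespace Summit.NavierStokesRegularity.NavierStokesRegularity.Cruxes.ScarEnvelopeTypeI.ForcedTsai

open scoped ContDiff
open Literature.Analysis.FluidPDE

/-- Coordinates are smooth. -/
theorem contDiff_coord (i : Fin 3) {n : WithTop ℕ∞} : ContDiff ℝ n (fun y : E3 => y i) :=
  (EuclideanSpace.proj i : E3 →L[ℝ] ℝ).contDiff

/-- Monomials are smooth. -/
theorem Mono.contDiff_eval (m : Mono) {n : WithTop ℕ∞} : ContDiff ℝ n (fun y : E3 => Mono.eval m y) := by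
  unfold Mono.eval
  exact ((contDiff_const.mul ((contDiff_coord 0).pow _)).mul ((contDiff_coord 1).pow _)).mul
    ((contDiff_coord 2).pow _)

/-- Sparse polynomials are smooth. -/
theorem QPoly.contDiff_eval (P : QPoly) {n : WithTop ℕ∞} : ContDiff ℝ n (fun y : E3 => QPoly.eval P y) := by
  induction P with
  | nil => simpa using contDiff_const
  | cons m P ih =>
    have : (fun y : E3 => QPoly.eval (m :: P) y) = fun y => Mono.eval m y + QPoly.eval P y := by funext y; simp
    rw [this]; exact (Mono.contDiff_eval m).add ih

/-- The Gaussian is smooth. -/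
theorem contDiff_gauss (b : ℝ) {n : WithTop ℕ∞} : ContDiff ℝ n (gauss b) := by
  have : gauss b = fun y : E3 => Real.exp (-b * QPoly.eval tPoly y) := by
    funext y
    have ht : QPoly.eval tPoly y = ‖y‖ ^ 2 := by
      rw [EuclideanSpace.real_norm_sq_eq, Fin.sum_univ_three]
      simp [QPoly.eval, tPoly, Mono.eval]
      ring
    rw [gauss, ht]
  rw [this]
  exact Real.contDiff_exp.comp (contDiff_const.mul (QPoly.contDiff_eval tPoly))

/-- Symbolic vector fields are smooth. -/
theorem contDiff_evalVec (V : Fin 3 → QPoly) {n : WithTop ℕ∞} : ContDiff ℝ n (evalVec V) :=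
  contDiff_euclidean.mpr fun i => by
    have : (fun y => evalVec V y i) = fun y => QPoly.eval (V i) y := by
      funext y; simp [evalVec, PiLp.toLp_apply]
    rw [this]; exact QPoly.contDiff_eval (V i)

/-- **The witness field is smooth** (first half of S1). -/
theorem WitnessRow.contDiff_field (r : WitnessRow) {n : WithTop ℕ∞} : ContDiff ℝ n r.field :=
  (contDiff_gauss r.aR).smul (contDiff_evalVec r.u)

end Summit.NavierStokesRegularity.NavierStokesRegularity.Cruxes.ScarEnvelopeTypeI.ForcedTsai

end
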